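import Summits.QuantumFields.YangMills.Theorems.BalabanUVNodesN07ShearLetterAffine
import HarnessLib

/-!
# N07 [B11] (= [15] = [Balaban1985Variational]) Sect. F, road of record R0′, WIDTH-209 row (r2), FILE 18: **THE ς-DOOR WITH THE SHEAR SIDE READ FROM FINE REGULARITY** —
# FILE 17's affine radial door with the per-level plaquette letters on the `□̃`-tower DISCHARGED from ONE fine-regularity hypothesis `PlaqSmallOn {q | q.src ∈ □̃_wide} (α₀η_k²) U`
# (dag-n07-w6 g2 p640582's [B7] Prop 2 port on the widened `□̃`-tower, plaquettes being gauge-invariant under both gauges)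

Cell `pub-ymgap`, width seat `pub-ymgap-dag-n07-w8` g6, WIDTH-209 N07 row (r2) of road R0′, CLAIM-17 ∕ INTENT-17 §3 — moved to its own module for the 400-line cap (DECL-DELTA on the cell bus);
own lineage FILE 17 → FILE 18, dag-n07-w6 g2's `N07TildeTowerLettersFromFine` CONSUMED BY NAME.  `--kind proof --supports stmt-QuantumFields-27364 --as helper` (K1⁹ per dag-lead KEY MAP v2);
count-neutral; def-free.  [15] = [Balaban1985Variational] (144)–(145) pp. 300–301, (150)–(152) p. 301, (157)–(159) pp. 302–303, (164)–(165) p. 304, (168) p. 304; [6] = [Balaban1985RegularSpaces] p. 98,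
Lemma 1 (1.25) p. 79; [B7] = [Balaban1985Averaging] Prop. 2 p. 22; [4] = [Balaban1984PropagatorsII] (2.1)–(2.4) p. 224, Cor. 2.8 p. 249.

THE POINT.  FILE 17 §2 displays, on the shear side, the per-level plaquette hypotheses of the averages `Mⁱ((U^{u})^{u♮})` around ∕ inside the `□̃`-tower boxes with letters `2α₀(Lⁱη_k)²` and their
[6] Lemma-1 smallness.  Plaquette variables are gauge-invariant (`dist1_plaqHol_iter_gaugeAct`, twice), so these are facts about `U` itself, and dag-n07-w6 g2's `plaqSmallOn_tildeTowerWide_of_fine`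
derives them at every level from `PlaqSmallOn (□̃_wide-based fine plaquettes) (α₀η_k²) U` ([B7] Prop 2, local `k`-fold), with `smallness_ht_of_alpha` for the Lemma-1 threshold and
`exists_label_near_of_block_position` ∕ `mem_tildeTowerWide_of_blockOf_mem` placing the three plaquette positions inside the widened family (their `…_of_fine` proof, followed line by line).
What stays displayed: `α₀` with `143((d+4)²∕4)²α₀ ≤ ⅓`, `2α₀ ≤ 2δ_N∕((d+4)L)²`; the radial WLOG `hax`; the top letter `v_k`; S3's `t` on `□′` and on `□̃`; the affine smallness
`2d(M+4ρ+1)(4κα₀ + v_k + 2t) ≤ ½`; the placement of `□̃_wide` in the (17)-region is the consumer's (dag-n07-w6 g2's OFFER FILE 3).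

WHAT IS PROVED (sorry-free; no definition; axioms standard).  ★★★★ `localGaugeSplitOn_of_gauge152_recordShearTildeTower_of_fine_cubeDomains_box F N`.
HONEST SCOPE.  Count-neutral by-name composition of LANDED theorems (FILE 17 §2; dag-n07-w6 g2 `N07TildeTowerLettersFromFine` §1–§3; dag-n07-w6 `dist1_plaqHol_iter_gaugeAct`); hypotheses as listed;
nothing of [15]∕[6]∕[B7]∕[4] ANALYSIS asserted beyond the landed ports; joint satisfiability with the head's budget NOT claimed; HCHART ∕ `LocalLettersSplitTopStepCore(G∕R)` ∕ `DatumGaugeSplitTopStepCore(G∕R)`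
∕ `HalvingStepTop(Core)` ∕ `stub_prop8StepCoP13` NOT discharged; K0⁷ ∕ K1⁹ NOT closed; N07 NOT discharged; counts unmoved (typed 28∕28 · discharged 5∕27); one finite 𝕋⁴ programme at fixed ε — the
route closes the conditional finite-𝕋⁴ rung `BalabanLadder.UV` ONLY; the YM mass gap (Clay) is NOT proved by any of this; nothing continuum ∕ ℝ⁴ ∕ OS.  No `sorry`, no `def`, no `instance`, no `notation`.

RELATED IN THE TREE, NOT DUPLICATED (stem check 2026-08-28T14:33Z: `ls …/Theorems | rg -i 'ShearLetterOfFine|LetterOfFine'` = ∅): FILE 17 (CONSUMED); dag-n07-w6 g2 `N07TildeTowerLettersFromFine.dist1_iter_le_down_the_radialRep_levelBoxes_of_fine`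
(the `v`-clause from the same hypothesis — the OTHER half of the head's data, not restated).
-/

set_option autoImplicit false

noncomputable section
open scoped BigOperators Matrix.Norms.L2Operator

namespace Summit.QuantumFields.YangMills.BalabanUVNodes.N07ShearLetterOfFine

open Literature.MathematicalPhysics.QuantumFieldTheory.Balaban1983to89
open Literature.MathematicalPhysics.QuantumFieldTheory.Balaban1983to89.Node00
open Literature.MathematicalPhysics.QuantumFieldTheory.Balaban1983to89.B12RegularSpaces111 (gaugeU expI grad)
open B15Eq112TorusCover (cover)
open B14DomainGeom (Pt)
open B8Eq131Cubes (gs sqLo sqHi tLo tHi box cube)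
open B8Ineq130 (tlo thi)
open B6SectAOperatorsV1 (BondIdx)
open T4Continuum (T4Family)
open T4AxialGaugeSmallField (castSite)
open B16Sect1Backgrounds (toMS)
open GaugeField (gaugeAct)
open MatrixLog (mlog)
open ExpMeanLog (deltaSU deltaSU_pos)
open Summit.QuantumFields.Balaban3D.Carriers (radialContourData)
open Summit.QuantumFields.YangMills.Theorems.K0FlatCubeOpsTextP (flatH)
open Summit.QuantumFields.YangMills.BalabanUVNodes.N07HalvingStepTopOfLocalLetters (Letters10On)
open Summit.QuantumFields.YangMills.BalabanUVNodes.N07LocalLettersSplitCore (LocalGaugeSplitOn)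
open Summit.QuantumFields.YangMills.BalabanUVNodes.N07ShearLetterAffine (localGaugeSplitOn_of_gauge152_recordShearRadialTildeTower_affine_cubeDomains_box)
open Summit.QuantumFields.YangMills.BalabanUVNodes.N07DataDownTheTowerBlowDown (dist1_plaqHol_iter_gaugeAct)
open Summit.QuantumFields.YangMills.BalabanUVNodes.N07TildeTowerLettersFromFine (plaqSmallOn_tildeTowerWide_of_fine smallness_ht_of_alpha
  exists_label_near_of_block_position mem_tildeTowerWide_of_blockOf_mem)

open scoped Classical in
/-- ★★★★ **THE ς-DOOR AT THE HEAD's FAMILY WITH THE SHEAR SIDE READ FROM FINE REGULARITY** (FILE 17 §2 ∘ dag-n07-w6 g2 p640582): statement = FILE 17's affine radial door with the plaquette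
hypotheses and their Lemma-1 smallness REPLACED by `0 < α₀`, `143((d+4)²∕4)²α₀ ≤ ⅓`, `2α₀ ≤ 2δ_N∕((d+4)L)²` and `PlaqSmallOn {q | q.src ∈ □̃_wide} (α₀η_{K−n}²) U`.
[cite: Balaban1985Variational, (144)–(145) pp.300–301, (150)–(152) p.301, (157)–(159) pp.302–303, (164)–(165) p.304, (168) p.304; Balaban1985RegularSpaces, p.98, Lemma 1 (1.25) p.79; Balaban1985Averaging, Prop. 2 p.22; Balaban1984PropagatorsII, (2.1)–(2.4) p.224, Cor. 2.8 (2.150)–(2.151) p.249] -/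
theorem localGaugeSplitOn_of_gauge152_recordShearTildeTower_of_fine_cubeDomains_box (F : T4Family) (N : ℕ) [NeZero N] :
    ∃ (Mh₀ R₀ : ℕ) (C δ₀ δ₁ B₃ : ℝ), 0 ≤ C ∧ 0 < δ₀ ∧ 0 < δ₁ ∧ 0 < B₃ ∧
    ∀ (n K : ℕ) (_ : 1 ≤ K - n) (_ : K - n + 1 ≤ F.m + K) (hk : K - n ≤ (F.P K).m + (F.P K).K)
      {Mh R a' : ℕ} (_ : Mh = F.L ^ a') (_ : Mh₀ ≤ Mh) (_ : R₀ ≤ R) (_ : a' + 3 ≤ F.m + n)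
      {a : Pt (F.P K).d} {M ρ : ℕ} (_ : 1 ≤ M)
      (_ : F.L * Mh ∣ ρ) (_ : ∀ i, ((F.L * Mh : ℕ) : ℤ) ∣ a i) (_ : F.L * Mh ∣ M) (_ : F.L * Mh ∣ (F.P K).sitesPerDir (K - n)) (_ : R * (F.L * Mh) ≤ ρ)
      (_ : F.L ≤ ρ) (_ : Set.InjOn (cover (F.P K)) (cube (F.P K).L a M ρ (K - n) 0))
      {HV : (BondIdx (cubeDomains (F.P K) a M ρ (K - n) hk) → MatA N) →ₗ[ℂ] (PBond (F.P K) 0 → MatA N)}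
      (_ : ∀ (B' : BondIdx (cubeDomains (F.P K) a M ρ (K - n) hk) → MatA N) (b : PBond (F.P K) 0),
        HV B' b = ∑ c, ((flatH (F.P K) (K - n) (cubeDomains (F.P K) a M ρ (K - n) hk) (Pi.single c 1) b : ℝ) : ℂ) • B' c)
      -- the CANONICAL level boxes of the tower (four equation binders)
      {lo hi : ℕ → Pt (F.P K).d}
      (_ : lo 0 = fun i => ((F.P K).L : ℤ) * (sqLo (F.P K).L a ρ (K - n) 1 i - 1))
      (_ : hi 0 = fun i => ((F.P K).L : ℤ) * (sqHi (F.P K).L a M ρ (K - n) 1 i + 1) + (((F.P K).L : ℤ) - 1))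
      (_ : ∀ j, 1 ≤ j → lo j = sqLo (F.P K).L a ρ (K - n) j - 1) (_ : ∀ j, 1 ≤ j → hi j = sqHi (F.P K).L a M ρ (K - n) j + 1)
      -- the shear gauge `u♮`; the shift family, DOMINATED by the (r1) letter family, and its datum
      (uL : GaugeTransf (F.P K) 0 (SU N))
      (lam : (j : ℕ) → Site (F.P K) j → MatA N)
      (_ : ∀ (j : ℕ) (y : Site (F.P K) j), ‖lam j y‖ ≤ ‖mlog (((((toMS uL j (castSite (lo j)))⁻¹ * toMS uL j y)⁻¹ : SU N)) : MatA N)‖)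
      {X : BondIdx (cubeDomains (F.P K) a M ρ (K - n) hk) → MatA N}
      (_ : ∀ c : BondIdx (cubeDomains (F.P K) a M ρ (K - n) hk),
        X c = LatticeFieldCalculus.grad (((F.P K).L : ℝ) ^ (K - n) / ((F.P K).L : ℝ) ^ (c.1.1 : ℕ)) (lam c.1.1) c.1.2)
      -- S3's gauge of `U` on the window, the (159)-splitting of `A − H_V X`
      {U : GaugeField (F.P K) 0 (SU N)} (u : GaugeTransf (F.P K) 0 (SU N)) {A A₁ A₂ A₃ : PBond (F.P K) 0 → MatA N} {t t₁ t₂ t₃ : ℝ}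
      (_ : ∀ b ∈ (Sect2.regionOfSet (F.P K) (cover (F.P K) '' box (F.P K).L a M (K - n))).bonds,
        gaugeU (fun x => ιSU N (u x)) (fun b' => ιSU N (U b')) b = expI ((F.P K).eta (K - n)) (A b))
      (_ : ∀ b ∈ (Sect2.regionOfSet (F.P K) (cover (F.P K) '' box (F.P K).L a M (K - n))).bonds, ‖A b‖ < t)
      (_ : ∀ q ∈ (Sect2.regionOfSet (F.P K) (cover (F.P K) '' box (F.P K).L a M (K - n))).dpairs,
        ‖grad ((F.P K).eta (K - n)) q.2.1 (fun y => A ⟨y, q.2.2⟩) q.1‖ < t)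
      (_ : ∀ b, A b - HV X b = A₁ b + A₂ b - A₃ b)
      (_ : Letters10On (cover (F.P K) '' box (F.P K).L a M (K - n)) ((F.P K).eta (K - n)) t₁ A₁)
      (_ : Letters10On (cover (F.P K) '' box (F.P K).L a M (K - n)) ((F.P K).eta (K - n)) t₂ A₂)
      (_ : Letters10On (cover (F.P K) '' box (F.P K).L a M (K - n)) ((F.P K).eta (K - n)) t₃ A₃)
      -- ★ the Landau side of the shear: the (152) equation and letter on a bond set containing the fine bonds of `□̃` (LOCATED-LANDAU-REGION), `0 ≤ t`, `η t ≤ 1`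
      (_ : 0 ≤ t) (_ : (F.P K).eta (K - n) * t ≤ 1) {B : Set (PBond (F.P K) 0)}
      (_ : ∀ b ∈ B, gaugeU (fun x => ιSU N (u x)) (fun b' => ιSU N (U b')) b = expI ((F.P K).eta (K - n)) (A b)) (_ : ∀ b ∈ B, ‖A b‖ < t)
      (_ : ∀ b : PBond (F.P K) 0,
        b.src ∈ (castSite '' Set.Icc (tlo (F.P K).L (tLo a ρ) (K - n - 0)) (thi (F.P K).L (tHi a M ρ) (K - n - 0)) : Set (Site (F.P K) 0)) →
        b.tgt ∈ (castSite '' Set.Icc (tlo (F.P K).L (tLo a ρ) (K - n - 0)) (thi (F.P K).L (tHi a M ρ) (K - n - 0)) : Set (Site (F.P K) 0)) → b ∈ B)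
      -- ★ `α₀` with its ranges, fine regularity near `□̃`, the radial WLOG and the top letter of the representative `(U^{u})^{u♮}`
      {α₀ : ℝ} (_ : 0 < α₀) (_ : (143 * (((((F.P K).d + 4 : ℕ) : ℝ)) ^ 2 / 4) ^ 2) * α₀ ≤ 1 / 3)
      (_ : 2 * α₀ ≤ 2 * deltaSU (Fin N) / ((((F.P K).d + 4) * (F.P K).L : ℕ) : ℝ) ^ 2)
      -- ★ ONE fine-regularity hypothesis on `U` near `□̃` (the widened fine box, margin `m₀ = (L + ((d+4)L+2))·gs L (K−n)`)
      (_ : PlaqSmallOn {q : Plaq (F.P K) 0 | ∃ x : Fin (F.P K).d → ℤ,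
          (∀ κ, tlo (F.P K).L (tLo a ρ) (K - n) κ - ((((F.P K).L + (((F.P K).d + 4) * (F.P K).L + 2)) * gs (F.P K).L (K - n) : ℕ) : ℤ) ≤ x κ ∧
            x κ ≤ thi (F.P K).L (tHi a M ρ) (K - n) κ + ((((F.P K).L + (((F.P K).d + 4) * (F.P K).L + 2)) * gs (F.P K).L (K - n) : ℕ) : ℤ)) ∧ q.src = castSite x}
        (α₀ * (F.P K).eta (K - n) ^ 2) U)
      {vk : ℝ} (_ : 0 ≤ vk)
      (_ : ∀ i < K - n, AxialGauge (radialContourData (F.P K) i (SU N)) (Averaging.iter (avOfRecord F N K) i (gaugeAct uL (gaugeAct u U))))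
      (_ : ∀ c : PBond (F.P K) (K - n),
        c.src ∈ (castSite '' Set.Icc (tlo (F.P K).L (tLo a ρ) (K - n - (K - n))) (thi (F.P K).L (tHi a M ρ) (K - n - (K - n))) : Set (Site (F.P K) (K - n))) →
        c.tgt ∈ (castSite '' Set.Icc (tlo (F.P K).L (tLo a ρ) (K - n - (K - n))) (thi (F.P K).L (tHi a M ρ) (K - n - (K - n))) : Set (Site (F.P K) (K - n))) →
        dist1 (Averaging.iter (avOfRecord F N K) (K - n) (gaugeAct uL (gaugeAct u U)) c) ≤ vk)
      -- ★ ONE smallness on the AFFINE shear letter `2d(M+4ρ+1)(4κα₀ + v_k + 2t)`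
      (_ : 2 * (((F.P K).d : ℝ) * (((M + 4 * ρ + 1 : ℕ) : ℝ) * (4 * ((((F.P K).d * ((F.P K).L - 1) + 1 : ℕ) : ℝ) * ((((F.P K).d - 1 : ℕ) : ℝ) * (((F.P K).L - 1 : ℕ) : ℝ)) + 7 * (((((F.P K).d + 2) * (F.P K).L : ℕ) : ℝ) ^ 2 / 4) + ((((F.P K).d + 1) * ((F.P K).L - 1) : ℕ) : ℝ) * ((((F.P K).d * ((F.P K).L - 1) + 1 : ℕ) : ℝ) * ((((F.P K).d - 1 : ℕ) : ℝ) * (((F.P K).L - 1 : ℕ) : ℝ)))) * α₀ + vk + 2 * t))) ≤ 1 / 2)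
      {tD : ℝ} (_ : 2 * C * B₃ * (4 * (2 * (((F.P K).d : ℝ) * (((M + 4 * ρ + 1 : ℕ) : ℝ) * (4 * ((((F.P K).d * ((F.P K).L - 1) + 1 : ℕ) : ℝ) * ((((F.P K).d - 1 : ℕ) : ℝ) * (((F.P K).L - 1 : ℕ) : ℝ)) + 7 * (((((F.P K).d + 2) * (F.P K).L : ℕ) : ℝ) ^ 2 / 4) + ((((F.P K).d + 1) * ((F.P K).L - 1) : ℕ) : ℝ) * ((((F.P K).d * ((F.P K).L - 1) + 1 : ℕ) : ℝ) * ((((F.P K).d - 1 : ℕ) : ℝ) * (((F.P K).L - 1 : ℕ) : ℝ)))) * α₀ + vk + 2 * t))))) < tD),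
      LocalGaugeSplitOn (cover (F.P K) '' box (F.P K).L a M (K - n)) ((F.P K).eta (K - n)) t (t₁ + (t₂ + tD) + t₃) U := by
  obtain ⟨Mh₀, R₀, C, δ₀, δ₁, B₃, hC, hδ₀, hδ₁, hB₃, hmain⟩ := localGaugeSplitOn_of_gauge152_recordShearRadialTildeTower_affine_cubeDomains_box F N
  refine ⟨Mh₀, R₀, C, δ₀, δ₁, B₃, hC, hδ₀, hδ₁, hB₃, ?_⟩
  intro n K hk1 hk' hk Mh R a' hMha hMh hR hsize a M ρ hM1 hρ ha hM hper hRρ hLρ hinj HV hHV lo hi hlo0 hhi0 hloj hhij uL lam hlam X hX U u A A₁ A₂ A₃ t t₁ t₂ t₃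
    he hA hdA h159 h₁ h₂ h₃ ht0 hηt B heB hAB hB α₀ hα hα3 hα2 h52 vk hvk hax htop hςaff tD htD
  -- dag-n07-w6 g2: [B7] Prop 2 down the widened `□̃`-tower of `U`
  obtain ⟨hlev, -⟩ := plaqSmallOn_tildeTowerWide_of_fine (F := F) (N := N) hk a M ρ hα hα3 hα2 h52
  refine hmain n K hk1 hk' hk hMha hMh hR hsize hM1 hρ ha hM hper hRρ hLρ hinj hHV hlo0 hhi0 hloj hhij uL lam hlam hX u he hA hdA h159 h₁ h₂ h₃
    ht0 hηt heB hAB hB hα.le hvk hax (fun i hi => smallness_ht_of_alpha (F.P K) deltaSU_pos hα2 hi.le) ?_ ?_ htop hςaff htD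
  · -- `hplaq`: the three block positions around a bond of `□̃^{(i+1)}` — plaquettes of the twice-gauged field are those of `U`
    intro i hi c hs htg q hq'
    rw [dist1_plaqHol_iter_gaugeAct (by omega), dist1_plaqHol_iter_gaugeAct (by omega)]
    obtain ⟨z', hz', hy⟩ := exists_label_near_of_block_position c hs htg (blockOf q.src)
      (by rcases hq' with h | h | h <;> simp [h])
    exact hlev i hi.le q (mem_tildeTowerWide_of_blockOf_mem (P := F.P K) a M ρ _ hk hi q
      (fun κ => by simpa only [Set.mem_Icc] using hz' κ) hy)
  · -- `hplaqB`: plaquettes based in a block of `□̃^{(i+1)}`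
    intro i hi y hy q hq'
    rw [dist1_plaqHol_iter_gaugeAct (by omega), dist1_plaqHol_iter_gaugeAct (by omega)]
    obtain ⟨s, hsI, hys⟩ := hy
    rw [Set.mem_Icc] at hsI
    exact hlev i hi.le q (mem_tildeTowerWide_of_blockOf_mem (P := F.P K) a M ρ _ hk hi q (z' := s)
      (fun κ => ⟨by linarith [hsI.1 κ], by linarith [hsI.2 κ]⟩) (by rw [hq', hys]))

end Summit.QuantumFields.YangMills.BalabanUVNodes.N07ShearLetterOfFine

end
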